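import Summits.Schanuel.Schanuel.Theorems.DiophantineDichotomyDefs
import Summits.Schanuel.Schanuel.Theorems.DiophantineDichotomyKhovanskiiApproxTypeSlotDichotomyTwo
import Summits.Schanuel.Schanuel.Theorems.DiophantineDichotomyKhovanskiiApproxTypePenaltyTransfer

/-!
# `stub_penaltySlotDichotomy_two` — the `n = 2` slot dichotomy in the Ably penalty class

Route `DiophantineDichotomy`, crux/support `KhovanskiiApproxType` (stmt-Schanuel-6116), line
`height-window-compactness`, registered stub `stub_penaltySlotDichotomy_two : SlotDichotomyXTwo`
(all objects from `Summits.Schanuel.Schanuel.Theorems.DiophantineDichotomyDefs`, namespace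
`…KhovanskiiApproxType.HeightWindowCompactness`).

The statement: at `θ = (s, e^s) ∈ ℂ⁴`, a primitive approximation measure with degree exponent `p`
at a pair `θ ∘ e` of coordinates in the penalty class `exp(κ d log(d+2))`, plus one-variable floors
with degree exponent `A` at both coordinates of the pair in the penalty class `exp(κ₁ D log(D+2))`,
give the PENALTY FORM of the crux `ApproxTypePenAt 2 s a κ' C'` with `a = A·p/(A+1) < 1` provided
`A·p < A + 1`.

The proof is a re-run of the landed `stub_slotDichotomy_two` (p75181,
`DiophantineDichotomyKhovanskiiApproxTypeSlotDichotomyTwo.lean`) with the polynomial height-free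
penalties replaced by the Ably class: slot dichotomy at `d^τ`, `τ = p/(A+1)`.  CASE 1 (both slots
of degree `≥ d^τ` over `ℚ`): the primitive measure on the pair at `d' = ⌈d^τ⌉`; the loss
`C d^{a+1}` goes into the class by `PenaltyTransfer.const_mul_rpow_le_exp`.  CASE 2 (a slot of
degree `< d^τ`): the floor at that slot applied to an irreducible integer factor `f` of the
challenger's polynomial there (`deg f = deg_ℚ`, height `≤ 2^d(d+1)H`, landed `abs_coeff_le_of_dvd`)
and the mean value estimate (landed `norm_aeval_sub_aeval_le`); the floor's penalty
`exp(κ₁ D log(D+2))`, `D = max 1 (deg f) ≤ d`, is `≤ exp(κ₁⁺ d log(d+2))`.  Two exponentials of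
the class add up in the class (`PenaltyTransfer.exp_add_exp_le`).  Everything is proved; no named
facts.
-/

noncomputable section

-- `Summit.Schanuel.Schanuel.…` is the mandated summit/sub-problem namespace (single-conjunct summit), hence:
set_option linter.dupNamespace false

namespace Summit.Schanuel.Schanuel.Cruxes.KhovanskiiApproxType.HeightWindowCompactness

open Summit.Schanuel.Schanuel.Cruxes.KhovanskiiApproxType.LwSmallHeight
open Polynomial

namespace PenaltySlotDichotomy

open PenaltyTransfer

/-! ## Bookkeeping in the penalty class (pure real analysis) -/

/-- CASE-1 bookkeeping in the penalty class: for `d' ≥ d^τ`, `p − τ = a ≥ 0`, `C ≤ C'` and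
`κ' ≥ κ⁺ + (C/log 3 + (a+1)) + 1/log 3`,
`C d^p (L + d)/d' + exp(κ d log(d+2)) ≤ C' d^a L + exp(κ' d log(d+2))`
(`d^p (L+d)/d' ≤ d^a (L + d)`, `C d^{a+1} ≤ exp((C/log 3 + a + 1) d log(d+2))`). [folklore] -/
theorem bookkeepingX_one {C C' p a τ κ κ' d d' L : ℝ} (hC : 0 < C) (hCC' : C ≤ C')
    (hd : 1 ≤ d) (hL : 0 ≤ L) (hτd' : d ^ τ ≤ d') (hpa : p - τ = a) (ha : 0 ≤ a)
    (hκ' : max κ 0 + (C / Real.log 3 + (a + 1)) + 1 / Real.log 3 ≤ κ') :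
    C * d ^ p * (L + d) / d' + Real.exp (κ * d * Real.log (d + 2)) ≤
      C' * d ^ a * L + Real.exp (κ' * d * Real.log (d + 2)) := by
  have hd0 : 0 < d := one_pos.trans_le hd
  have hdτ : 0 < d ^ τ := Real.rpow_pos_of_pos hd0 τ
  have hda0 : 0 ≤ d ^ a := (Real.rpow_pos_of_pos hd0 a).le
  have h3 : 0 < Real.log 3 := Real.log_pos (by norm_num)
  have hu0 : 0 ≤ d * Real.log (d + 2) := mul_nonneg hd0.le (Real.log_nonneg (by linarith))
  have hu : Real.log 3 ≤ d * Real.log (d + 2) := log_three_le_mul_log hd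
  -- the main term
  have h1 : C * d ^ p * (L + d) / d' ≤ C * d ^ a * L + C * d ^ (a + 1) := by
    have e1 : d ^ p = d ^ a * d ^ τ := by rw [← Real.rpow_add hd0, ← hpa, sub_add_cancel]
    have e2 : d ^ (a + 1) = d ^ a * d := Real.rpow_add_one hd0.ne' a
    rw [e1, e2, div_le_iff₀ (hdτ.trans_le hτd')]
    have hX : 0 ≤ C * d ^ a * (L + d) := mul_nonneg (mul_nonneg hC.le hda0) (by linarith)
    calc C * (d ^ a * d ^ τ) * (L + d) = C * d ^ a * (L + d) * d ^ τ := by ring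
      _ ≤ C * d ^ a * (L + d) * d' := mul_le_mul_of_nonneg_left hτd' hX
      _ = (C * d ^ a * L + C * (d ^ a * d)) * d' := by ring
  -- the polynomial loss is in the class
  have h2 : C * d ^ (a + 1) ≤ Real.exp ((C / Real.log 3 + (a + 1)) * (d * Real.log (d + 2))) :=
    const_mul_rpow_le_exp hC (by linarith) hd
  -- the given penalty, with a non-negative coefficient
  have h4 : Real.exp (κ * d * Real.log (d + 2)) ≤ Real.exp (max κ 0 * (d * Real.log (d + 2))) := by
    rw [Real.exp_le_exp, mul_assoc]
    exact mul_le_mul_of_nonneg_right (le_max_left _ _) hu0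
  -- two exponentials of the class add up in the class
  have h5 := exp_add_exp_le (le_max_right κ 0) (add_nonneg (div_nonneg hC.le h3.le) (by linarith))
    hu0 hu (a := max κ 0) (b := C / Real.log 3 + (a + 1))
  have h6 : Real.exp ((max κ 0 + (C / Real.log 3 + (a + 1)) + 1 / Real.log 3) *
      (d * Real.log (d + 2))) ≤ Real.exp (κ' * d * Real.log (d + 2)) := by
    rw [Real.exp_le_exp, mul_assoc κ']
    exact mul_le_mul_of_nonneg_right hκ' hu0
  have h7 : C * d ^ a * L ≤ C' * d ^ a * L :=
    mul_le_mul_of_nonneg_right (mul_le_mul_of_nonneg_right hCC' hda0) hL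
  linarith [h1, h2, h4, h5, h6, h7]

/-- CASE-2 bookkeeping in the penalty class: the slot floor's exponent plus the mean-value losses
is at most `C' d^a L + exp(κ' d log(d+2))` for `τ A = a ≥ 0`, `C' ≥ C₁ + 1`,
`κ' ≥ κ₁⁺ + ((2C₁ + 4 + log R)/log 3 + (a+1)) + 1/log 3` (`κ₁⁺ = max κ₁ 0`). [folklore] -/
theorem bookkeepingX_two {C₁ C' A a τ κ₁ κ' d L lR : ℝ} (hC₁ : 0 < C₁) (hC' : C₁ + 1 ≤ C')
    (hlR : 0 ≤ lR) (hd : 1 ≤ d) (hL : 0 ≤ L) (hτA : τ * A = a) (ha : 0 ≤ a)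
    (hκ' : max κ₁ 0 + ((2 * C₁ + 4 + lR) / Real.log 3 + (a + 1)) + 1 / Real.log 3 ≤ κ') :
    C₁ * (d ^ τ) ^ A * (2 * d + L) + Real.exp (max κ₁ 0 * d * Real.log (d + 2)) +
        ((4 + lR) * d + L) ≤
      C' * d ^ a * L + Real.exp (κ' * d * Real.log (d + 2)) := by
  have hd0 : 0 < d := one_pos.trans_le hd
  have hda1 : 1 ≤ d ^ a := Real.one_le_rpow hd ha
  have hda0 : 0 ≤ d ^ a := zero_le_one.trans hda1
  have h3 : 0 < Real.log 3 := Real.log_pos (by norm_num)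
  have hu0 : 0 ≤ d * Real.log (d + 2) := mul_nonneg hd0.le (Real.log_nonneg (by linarith))
  have hu : Real.log 3 ≤ d * Real.log (d + 2) := log_three_le_mul_log hd
  rw [show (d ^ τ) ^ A = d ^ a by rw [← Real.rpow_mul hd0.le, hτA]]
  have hK0 : 0 < 2 * C₁ + 4 + lR := by linarith
  -- the polynomial junk: `(2C₁ + 4 + log R) d^{a+1}` is in the class
  have h1 : (2 * C₁ + 4 + lR) * d ^ (a + 1) ≤
      Real.exp (((2 * C₁ + 4 + lR) / Real.log 3 + (a + 1)) * (d * Real.log (d + 2))) :=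
    const_mul_rpow_le_exp hK0 (by linarith) hd
  have e2 : d ^ (a + 1) = d ^ a * d := Real.rpow_add_one hd0.ne' a
  have h2 : (4 + lR) * d ≤ (4 + lR) * (d ^ a * d) := by
    refine mul_le_mul_of_nonneg_left ?_ (by linarith)
    exact le_mul_of_one_le_left hd0.le hda1
  have h4 : L ≤ d ^ a * L := le_mul_of_one_le_left hL hda1
  have h5 := exp_add_exp_le (le_max_right κ₁ 0) (add_nonneg (div_nonneg hK0.le h3.le) (by linarith))
    hu0 hu (a := max κ₁ 0) (b := (2 * C₁ + 4 + lR) / Real.log 3 + (a + 1))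
  have h6 : Real.exp ((max κ₁ 0 + ((2 * C₁ + 4 + lR) / Real.log 3 + (a + 1)) + 1 / Real.log 3) *
      (d * Real.log (d + 2))) ≤ Real.exp (κ' * d * Real.log (d + 2)) := by
    rw [Real.exp_le_exp, mul_assoc κ']
    exact mul_le_mul_of_nonneg_right hκ' hu0
  have h7 : (C₁ + 1) * (d ^ a * L) ≤ C' * (d ^ a * L) :=
    mul_le_mul_of_nonneg_right hC' (mul_nonneg hda0 hL)
  have h8 : Real.exp (max κ₁ 0 * d * Real.log (d + 2)) = Real.exp (max κ₁ 0 * (d * Real.log (d + 2))) := by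
    rw [mul_assoc]
  rw [e2] at h1
  nlinarith [h1, h2, h4, h5, h6, h7, h8, mul_nonneg hC₁.le (mul_nonneg hda0 hL),
    mul_nonneg hC₁.le (mul_nonneg hda0 hd0.le)]

/-- SMALL-SLOT REPULSION IN THE PENALTY CLASS: if the root `α` of `P ≠ 0` (`deg P ≤ d`, height
`≤ H`) has degree `≤ d^τ` over `ℚ`, the floor `(A, κ₁, C₁)` at `ξ` applied to an irreducible factor
`f` of `P` with `f(α) = 0` (`D = max 1 (deg f) ≤ min(d, d^τ)`, `log H(f) ≤ 2d + log H`) and the mean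
value estimate `|f(ξ)| = |f(ξ) − f(α)| ≤ exp((4 + log R) d + log H)|ξ − α|` (`‖ξ‖, ‖α‖ ≤ R`) give
`exp(−(C₁ (d^τ)^A (2d + log H) + exp(κ₁⁺ d log(d+2)))) ≤ exp((4 + log R) d + log H) · |α − ξ|`.
[folklore] -/
theorem slot_repulsionX {ξ α : ℂ} {A κ₁ C₁ τ R : ℝ} {P : ℤ[X]} {d H : ℕ}
    (hfloor : SlotFloorX ξ A κ₁ C₁) (hA : 0 < A)
    (hP0 : P ≠ 0) (hPdeg : P.natDegree ≤ d) (hPH : ∀ k, |P.coeff k| ≤ (H : ℤ))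
    (hPα : aeval α P = 0) (hdeg : ((minpoly ℚ α).natDegree : ℝ) ≤ (d : ℝ) ^ τ)
    (hd1 : (1 : ℝ) ≤ d) (hH1 : (1 : ℝ) ≤ H) (hR : 1 ≤ R) (hξR : ‖ξ‖ ≤ R) (hαR : ‖α‖ ≤ R) :
    Real.exp (-(C₁ * ((d : ℝ) ^ τ) ^ A * (2 * d + Real.log H) +
        Real.exp (max κ₁ 0 * d * Real.log ((d : ℝ) + 2)))) ≤
      Real.exp ((4 + Real.log R) * d + Real.log H) * ‖α - ξ‖ := by
  have hd0 : (0 : ℝ) < d := one_pos.trans_le hd1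
  have hH0 : (0 : ℝ) < H := one_pos.trans_le hH1
  have hdτ0 : 0 < (d : ℝ) ^ τ := Real.rpow_pos_of_pos hd0 τ
  obtain ⟨f, hfirr, hfP, hfα⟩ := exists_irreducible_factor_aeval_eq_zero α P hP0 hPα
  have hf0 : f ≠ 0 := hfirr.ne_zero
  have hfd : f.natDegree ≤ d := (natDegree_le_of_dvd hfP hP0).trans hPdeg
  have hfτ : (f.natDegree : ℝ) ≤ (d : ℝ) ^ τ := by
    rw [natDegree_eq_of_irreducible_of_aeval_eq_zero hfirr hfα]; exact hdeg
  have hf1 : (1 : ℝ) ≤ f.natDegree := by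
    exact_mod_cast (natDegree_pos_of_aeval_eq_zero hf0 hfα).1
  set Bh : ℝ := 2 ^ d * ((d : ℝ) + 1) * H with hBh
  have hcoeff : ∀ k, |(f.coeff k : ℝ)| ≤ Bh := abs_coeff_le_of_dvd hfP hP0 hPdeg hPH
  have j1 : (d : ℝ) + 1 ≤ Real.exp d := Real.add_one_le_exp d
  have j2 : (2 : ℝ) ^ d ≤ Real.exp d := by
    calc (2 : ℝ) ^ d ≤ (Real.exp 1) ^ d :=
          pow_le_pow_left₀ (by norm_num) (by linarith [Real.add_one_le_exp (1 : ℝ)]) d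
      _ = Real.exp d := by rw [← Real.exp_nat_mul, mul_one]
  have hBh1 : 1 ≤ Bh :=
    one_le_mul_of_one_le_of_one_le (one_le_mul_of_one_le_of_one_le (one_le_pow₀ (by norm_num))
      (by linarith)) hH1
  have hBh0 : 0 < Bh := one_pos.trans_le hBh1
  have hlogBh : Real.log Bh ≤ 2 * d + Real.log H := by
    have h : Bh ≤ Real.exp d * Real.exp d * H := by rw [hBh]; gcongr
    have h' := Real.log_le_log hBh0 h
    rw [Real.log_mul (mul_pos (Real.exp_pos _) (Real.exp_pos _)).ne' hH0.ne',
      Real.log_mul (Real.exp_pos _).ne' (Real.exp_pos _).ne', Real.log_exp] at h'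
    linarith
  have hkey := hfloor.2 (f.toMvPolynomial (0 : Fin 1))
    (fun h => hf0 (Polynomial.toMvPolynomial_injective (0 : Fin 1) (by rw [h, map_zero])))
  rw [MvPolynomial.aeval_toMvPolynomial] at hkey
  set X₁ : ℝ := max 1 ((f.toMvPolynomial (0 : Fin 1)).totalDegree : ℝ) with hX₁
  set Y₁ : ℝ := max 1 (mvNatHeight (f.toMvPolynomial (0 : Fin 1)) : ℝ) with hY₁
  have hnat : ∀ k, (f.coeff k).natAbs ≤ ⌊Bh⌋₊ := fun k => by
    rw [Nat.le_floor_iff hBh0.le, ← Int.cast_natCast, Int.natCast_natAbs, Int.cast_abs]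
    exact hcoeff k
  obtain ⟨hFdeg, hFht⟩ := totalDegree_mvNatHeight_toMvPolynomial_le f ⌊Bh⌋₊ hnat
  have hX1 : 1 ≤ X₁ := le_max_left _ _
  have hX0 : 0 ≤ X₁ := zero_le_one.trans hX1
  have hXτ : X₁ ≤ (d : ℝ) ^ τ :=
    max_le (hf1.trans hfτ) (le_trans (by exact_mod_cast hFdeg) hfτ)
  have hXd : X₁ ≤ d := max_le hd1 (by exact_mod_cast hFdeg.trans hfd)
  have hY1 : 1 ≤ Y₁ := le_max_left _ _
  have hYB : Y₁ ≤ Bh :=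
    max_le hBh1 ((show (mvNatHeight (f.toMvPolynomial (0 : Fin 1)) : ℝ) ≤ (⌊Bh⌋₊ : ℝ) by
      exact_mod_cast hFht).trans (Nat.floor_le hBh0.le))
  -- the floor's main term
  have hmain : C₁ * X₁ ^ A * Real.log Y₁ ≤ C₁ * ((d : ℝ) ^ τ) ^ A * (2 * d + Real.log H) := by
    rw [mul_assoc, mul_assoc]
    exact mul_le_mul_of_nonneg_left (mul_le_mul (Real.rpow_le_rpow hX0 hXτ hA.le)
      ((Real.log_le_log (one_pos.trans_le hY1) hYB).trans hlogBh) (Real.log_nonneg hY1)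
      (Real.rpow_pos_of_pos hdτ0 A).le) hfloor.1.le
  -- the floor's penalty term: `κ₁ X₁ log(X₁+2) ≤ κ₁⁺ d log(d+2)`
  have hpen : Real.exp (κ₁ * X₁ ^ (1 : ℕ) * Real.log (X₁ + 2)) ≤
      Real.exp (max κ₁ 0 * d * Real.log ((d : ℝ) + 2)) := by
    rw [pow_one, Real.exp_le_exp]
    have hlX0 : 0 ≤ Real.log (X₁ + 2) := Real.log_nonneg (by linarith)
    have hlX : Real.log (X₁ + 2) ≤ Real.log ((d : ℝ) + 2) :=
      Real.log_le_log (by linarith) (by linarith)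
    have hκ0 : 0 ≤ max κ₁ 0 := le_max_right _ _
    calc κ₁ * X₁ * Real.log (X₁ + 2) ≤ max κ₁ 0 * X₁ * Real.log (X₁ + 2) :=
          mul_le_mul_of_nonneg_right (mul_le_mul_of_nonneg_right (le_max_left _ _) hX0) hlX0
      _ ≤ max κ₁ 0 * d * Real.log ((d : ℝ) + 2) :=
          mul_le_mul (mul_le_mul_of_nonneg_left hXd hκ0) hlX hlX0 (mul_nonneg hκ0 hd0.le)
  have hE1 : Real.exp (-(C₁ * ((d : ℝ) ^ τ) ^ A * (2 * d + Real.log H) +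
      Real.exp (max κ₁ 0 * d * Real.log ((d : ℝ) + 2)))) ≤ ‖aeval ξ f‖ :=
    le_trans (Real.exp_le_exp.2 (neg_le_neg (add_le_add hmain hpen))) hkey
  have hmv : ‖aeval ξ f‖ ≤ ((d : ℝ) + 1) * (Bh * (d * R ^ d)) * ‖ξ - α‖ := by
    simpa only [hfα, sub_zero] using norm_aeval_sub_aeval_le f hR hξR hαR hcoeff hfd
  have hD : ((d : ℝ) + 1) * (Bh * (d * R ^ d)) ≤ Real.exp ((4 + Real.log R) * d + Real.log H) := by
    have e1 : Real.exp d * Real.exp d * Real.exp d * Real.exp d * R ^ d * H =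
        Real.exp ((4 + Real.log R) * d + Real.log H) := by
      rw [show (4 + Real.log R) * d + Real.log H =
          (d : ℝ) + d + d + d + Real.log R * d + Real.log H by ring]
      simp only [Real.exp_add]
      rw [Real.exp_log hH0, ← Real.rpow_def_of_pos (one_pos.trans_le hR), Real.rpow_natCast]
    have j3 : (d : ℝ) ≤ Real.exp d := by linarith
    rw [← e1, hBh]
    calc ((d : ℝ) + 1) * (2 ^ d * ((d : ℝ) + 1) * H * (d * R ^ d))
        = ((d : ℝ) + 1) * 2 ^ d * ((d : ℝ) + 1) * d * R ^ d * H := by ring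
      _ ≤ Real.exp d * Real.exp d * Real.exp d * Real.exp d * R ^ d * H := by gcongr
  rw [norm_sub_rev]
  exact hE1.trans (hmv.trans (mul_le_mul_of_nonneg_right hD (norm_nonneg _)))

end PenaltySlotDichotomy

open PenaltySlotDichotomy

/-! ## The slot dichotomy in the penalty class -/

/-- `stub_penaltySlotDichotomy_two` (registered stub of line `height-window-compactness`, crux
stmt-Schanuel-6116): the `n = 2` SLOT DICHOTOMY IN THE ABLY PENALTY CLASS — at `θ = (s, e^s) ∈ ℂ⁴`,
a primitive approximation measure `(p, κ, C)` at the pair `θ ∘ e` plus slot floors `(A, κ₁, C₁)` at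
both `θ (e i)` give the penalty form `ApproxTypePenAt 2 s a κ' C'` with `a = A p/(A+1) < 1`,
`C' = C + C₀ + C₁ + 1`, `κ'` the sum of the three class coefficients of the bookkeeping
(`τ = p/(A+1)`; dichotomy at `d^τ`). [folklore] -/
theorem stub_penaltySlotDichotomy_two : SlotDichotomyXTwo := by
  intro s e p κ C A _ hp hA hrace hPM hfl
  choose κf Cf hKC using hfl
  set θ : Fin 2 ⊕ Fin 2 → ℂ := Sum.elim s (Complex.exp ∘ s) with hθ
  set τ : ℝ := p / (A + 1) with hτ
  set a : ℝ := A * p / (A + 1) with ha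
  set R : ℝ := ‖θ‖ + 2 with hR
  set C' : ℝ := C + Cf 0 + Cf 1 + 1 with hC'
  set k₀ : ℝ := max κ 0 + (C / Real.log 3 + (a + 1)) + 1 / Real.log 3 with hk₀
  set k₁ : Fin 2 → ℝ := fun i =>
    max (κf i) 0 + ((2 * Cf i + 4 + Real.log R) / Real.log 3 + (a + 1)) + 1 / Real.log 3 with hk₁
  set κ' : ℝ := k₀ + k₁ 0 + k₁ 1 with hκ'
  have hA1 : 0 < A + 1 := by linarith
  have hτ0 : 0 ≤ τ := div_nonneg hp hA1.le
  have ha0 : 0 ≤ a := div_nonneg (mul_nonneg hA.le hp) hA1.le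
  have ha1 : a < 1 := by rw [ha, div_lt_one hA1]; exact hrace
  have hpa : p - τ = a := by rw [hτ, ha]; field_simp; ring
  have hτA : τ * A = a := by rw [hτ, ha]; ring
  have hC0 : 0 < C := hPM.1
  have hCf0 : 0 < Cf 0 := (hKC 0).1
  have hCf1 : 0 < Cf 1 := (hKC 1).1
  have hR1 : 1 ≤ R := by have := norm_nonneg θ; rw [hR]; linarith
  have hlogR : 0 ≤ Real.log R := Real.log_nonneg hR1
  have h3 : 0 < Real.log 3 := Real.log_pos (by norm_num)
  have hC'pos : 0 < C' := by rw [hC']; linarith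
  have hCC' : C ≤ C' := by rw [hC']; linarith
  have hCall : ∀ i : Fin 2, Cf i + 1 ≤ C' := Fin.forall_fin_two.2
    ⟨by rw [hC']; linarith, by rw [hC']; linarith⟩
  have hk₀0 : 0 ≤ k₀ := by
    rw [hk₀]
    exact add_nonneg (add_nonneg (le_max_right _ _) (add_nonneg (div_nonneg hC0.le h3.le)
      (by linarith))) (div_nonneg zero_le_one h3.le)
  have hk₁0 : ∀ i, 0 ≤ k₁ i := fun i => by
    have hCfi : 0 < Cf i := (hKC i).1
    simp only [hk₁]
    exact add_nonneg (add_nonneg (le_max_right _ _) (add_nonneg (div_nonneg (by linarith) h3.le)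
      (by linarith))) (div_nonneg zero_le_one h3.le)
  have hk₀κ : k₀ ≤ κ' := by rw [hκ']; linarith [hk₁0 0, hk₁0 1]
  have hk₁κ : ∀ i : Fin 2, k₁ i ≤ κ' := Fin.forall_fin_two.2
    ⟨by rw [hκ']; linarith [hk₁0 1], by rw [hκ']; linarith [hk₁0 0]⟩
  refine ⟨a, κ', C', ha1, hC'pos, ?_⟩
  intro d H γ hfr hpoly
  obtain ⟨P₀, hP₀0, hP₀deg, hP₀H, hP₀γ⟩ := hpoly (e 0)
  have hd1 : 1 ≤ d := (natDegree_pos_of_aeval_eq_zero hP₀0 hP₀γ).1.trans_le hP₀deg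
  have hH1 : (1 : ℤ) ≤ H :=
    (Int.one_le_abs (leadingCoeff_ne_zero.2 hP₀0)).trans (hP₀H P₀.natDegree)
  have hint : ∀ j, IsIntegral ℚ (γ j) := fun j => by
    obtain ⟨P, hP0, -, -, hPγ⟩ := hpoly j
    exact (natDegree_pos_of_aeval_eq_zero hP0 hPγ).2
  have hd1r : (1 : ℝ) ≤ d := by exact_mod_cast hd1
  have hH1r : (1 : ℝ) ≤ H := by exact_mod_cast hH1
  have hd0 : (0 : ℝ) < d := one_pos.trans_le hd1r
  have hlogH : 0 ≤ Real.log H := Real.log_nonneg hH1r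
  have hX0 : 0 ≤ C' * (d : ℝ) ^ a * Real.log H + Real.exp (κ' * d * Real.log ((d : ℝ) + 2)) :=
    add_nonneg (mul_nonneg (mul_nonneg hC'pos.le (Real.rpow_pos_of_pos hd0 a).le) hlogH)
      (Real.exp_pos _).le
  by_cases hfar : 1 < ‖γ - θ‖
  · exact le_trans (by rw [Real.exp_le_one_iff]; linarith) hfar.le
  push Not at hfar
  have hcoord : ∀ j, ‖γ j - θ j‖ ≤ ‖γ - θ‖ := fun j => by simpa using norm_le_pi_norm (γ - θ) j
  have hθj : ∀ j, ‖θ j‖ ≤ ‖θ‖ := fun j => norm_le_pi_norm θ j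
  by_cases hsmall : ∃ i : Fin 2, ((minpoly ℚ (γ (e i))).natDegree : ℝ) < (d : ℝ) ^ τ
  · obtain ⟨i, hi⟩ := hsmall -- CASE 2: a slot of small degree — floor at that slot + mean value
    obtain ⟨P, hP0, hPdeg, hPH, hPγ⟩ := hpoly (e i)
    have hξR : ‖θ (e i)‖ ≤ R := by have := hθj (e i); rw [hR]; linarith
    have hαR : ‖γ (e i)‖ ≤ R := by
      linarith [hcoord (e i), hθj (e i), norm_sub_norm_le (γ (e i)) (θ (e i))]
    have hrep := slot_repulsionX (hKC i) hA hP0 hPdeg hPH hPγ hi.le hd1r hH1r hR1 hξR hαR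
    have hbk := bookkeepingX_two (hKC i).1 (hCall i) hlogR hd1r hlogH hτA ha0 (hk₁κ i)
      (d := (d : ℝ))
    have hmul : Real.exp ((4 + Real.log R) * d + Real.log H) *
        Real.exp (-(C' * (d : ℝ) ^ a * Real.log H + Real.exp (κ' * d * Real.log ((d : ℝ) + 2)))) ≤
        Real.exp ((4 + Real.log R) * d + Real.log H) * ‖γ (e i) - θ (e i)‖ := by
      rw [← Real.exp_add]
      exact le_trans (Real.exp_le_exp.2 (by linarith)) hrep
    exact (le_of_mul_le_mul_left hmul (Real.exp_pos _)).trans (hcoord (e i))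
  · push Not at hsmall -- CASE 1: both slots of degree `≥ d^τ` — the primitive measure on the pair
    have hfr' : Module.finrank ℚ ↥(IntermediateField.adjoin ℚ (Set.range (γ ∘ e))) ≤ d := by
      refine le_trans ?_ hfr
      haveI : FiniteDimensional ℚ ↥(IntermediateField.adjoin ℚ (Set.range γ)) :=
        IntermediateField.finiteDimensional_adjoin (fun x hx => by
          obtain ⟨j, rfl⟩ := hx
          exact hint j)
      exact IntermediateField.finrank_le_of_le_right
        (IntermediateField.adjoin.mono ℚ _ _ (Set.range_comp_subset_range e γ))
    have hkey := hPM.2 d ⌈(d : ℝ) ^ τ⌉₊ H (γ ∘ e)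
      (Nat.one_le_ceil_iff.2 (Real.rpow_pos_of_pos hd0 _)) hfr' (fun i => Nat.ceil_le.2 (hsmall i))
      (fun i => hpoly (e i))
    have hbk := bookkeepingX_one hC0 hCC' hd1r hlogH (Nat.le_ceil ((d : ℝ) ^ τ)) hpa ha0 hk₀κ
      (κ := κ)
    have hsup : ‖γ ∘ e - θ ∘ e‖ ≤ ‖γ - θ‖ :=
      (pi_norm_le_iff_of_nonneg (norm_nonneg _)).2 fun i => by
        simpa using norm_le_pi_norm (γ - θ) (e i)
    exact le_trans (Real.exp_le_exp.2 (by linarith)) (hkey.trans hsup)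

end Summit.Schanuel.Schanuel.Cruxes.KhovanskiiApproxType.HeightWindowCompactness

end
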